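import Literature.MathematicalPhysics.QuantumFieldTheory.Balaban1983to89.B8SockB9P3SrcAtPeriodizedTower
import Literature.MathematicalPhysics.QuantumFieldTheory.Balaban1983to89.B8IdxB8SubDPeriodize

/-!
# `Balaban1983to89.B8SockB9P3SrcAtPeriodizedTowerMember` — [Balaban1985RegularSpaces] (1.146) p. 101, (1.59) p. 86, (1.5) p. 77, (1.131) p. 99, p. 77 («Ω_j = T_η»): the
# per-shape SOURCED socket of `B8SockB9P3SrcAtPeriodizedTower` READ AT THE INDEX MEMBERS — every law member `i : ZdIdx` with `i.Ω = periodize (fun _ ↦ P)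
# (cubeFam true θ.L a M ρ k)`, `i.k = k` (families = print's `Lam` by dag-n05-w2's rigidity), and every member of the periodic cut `IdxB8SubDPer θ P` over that tower

statement-level skeleton of published theorems with citation tags; proofs where landed; nothing here is a claim about the
Yang–Mills mass gap

`[Balaban1985RegularSpaces]` ("B8", CMP **99** (1985) 75–102) (1.146) p. 101, (1.57)–(1.59) p. 86, (1.5)–(1.6) p. 77, (1.68) p. 88, (1.131) p. 99, (1.31) p. 82, p. 77;
[4] = `[Balaban1985BackgroundPropagators]` Thm 3.3 p. 399, (3.40) p. 397; [B6] = `[Balaban1984PropagatorsII]` (2.1)–(2.3) p. 224; [B11] = `[Balaban1985Variational]`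
(3) p. 278.

CITATION HEADER (lean-in-tree rule).  Cell `pub-ymgap` (YM Track A, HUMAN RULING D-0062 ∕ D-0149), node N05 = [B8], width seat `pub-ymgap-dag-n05-w3` (g5), CLAIM-2
file (D4) — the periodic twin of g4's `B8SockB9P3SrcAtTopCubeTowerMember` (p635551).  WHY.  The slot's binder `SB9srcHP : ∀ i, … → [sourced (1.59) lines in i.η,
i.k, i.Ω, i.Λs i.k]` reads an index member's OWN restriction families; file (D3) is stated for families that ARE print's level sets up to the depth; dag-n05-w2's
rigidity (`Λs_eq_lam_of_lamTop`) closes the gap by name, and the periodic cut `IdxB8SubDPer θ P` (dag-n05-w1's (P2) index of the (β′-PERIODIC) road, director-ym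
№217) carries the periodised Sect.-F tower (dag-n05-w2 `exists_idxB8SubDPer_periodize_cubeFam`).

THE MATHEMATICS (kernel-checked).  ★★★ `sockB9P3src_periodize_lawMember` (`∀ a P`, `θ.Lᵏ ∣ P`, `θ.Lᵏ·M + 2·ρ·gs θ.L k ≤ P`, `∀ i : ZdIdx θ.D θ.L` with `i.Ω = Ωᴾ`,
`i.k = k`, `IdxB8Laws`, `DomainSeq`, (1.5) ⊢ the `SB9srcHP` body VERBATIM in `i`'s letters); ★★ `sockB9P3src_periodize_lawMember_onePoint` ([4] (3.40)'s one-point pair class on line 5 — the `SB9srcH` letter of the HPGamma road); ★★★ `sockB9P3src_periodize_idxB8SubDPer` (the same at every member of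
the periodic cut over `Ωᴾ`).

HONEST SCOPE ∕ A6.  Constants depend on the SHAPE `(L, M, ρ, k)`, `β`, `d`, `θ.𝔸`, `len`, `γ₈` — NOT on `P`, `a`, `η`: the positive A6 datum for the `SB9srcHP`-shape body
at NESTED `P`-periodic (1.5)-members; NOT [4] Thm 3.3 with source (uniform constants = N06); no letter of [4] assumed or proved; inhabits no knit hypothesis as typed;
nothing of dag-n05-w1's ∕ dag-n05-w2's files restated.  Count-neutral; N05 NOT discharged; no count claim; one finite `𝕋⁴` programme at fixed `ε`, Bałaban as
printed; the YM mass gap (Clay) is NOT proved by any of this — R4 closes the conditional finite-`𝕋⁴` rung `BalabanLadder.UV` only; nothing continuum ∕ ℝ⁴ ∕ OS.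
No `sorry`, no `def`, no `instance`, no `notation`.  Unit `pub-ymgap-dag-n05-w3` (g5), 2026-08-28.
-/

noncomputable section

namespace Literature.MathematicalPhysics.QuantumFieldTheory.Balaban1983to89.B8SockB9P3SrcAtPeriodizedTowerMember

open B7Prop1Explicit B7Prop1Local
open B7Prop2Explicit (unitaryUnits)
open B7Prop4GeneralLevels (linCovIter)
open B8Ineq132 (covDerivFwd InAk)
open B8Eq140Level (SideTouches)
open B8Eq146AExpansion (iEta plaqCovDeriv)
open B8Eq143PlaqExpansion (pdiv)
open B8Eq155JBound (Jcur wsup)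
open B8ScaledSupNorm (bondNorm msup Bdd)
open B8Eq138LandauZd (IsLandau146W InR138 covLap)
open B8Eq184Proof (cfgExp)
open B8Lemma1NonAbelian (mulCfg)
open B9Eq340HolderZd (hquot AdmPair)
open B8LeafModelZd (ZdIdx)
open B8ConstraintBonds (DomainSeq Lam)
open B8Eq131Cubes (cube gs)
open B8Eq131CubesAdmissible (cubeFam)
open B8CubeMemberZd (cubeLamS)
open B8TowerBondsPrinted (towerBondsP)
open B8IdxB8SubDRigidity (Λs_eq_lam_of_lamTop)
open B8SockB9P3SrcAtPeriodizedTower (srcLines_periodize exists_sockB9P3src_periodize)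
open B15LatticeCubeTorus (periodize)
open Node00 (Stage3Params IdxB8Laws IdxB8SubD IdxB8SubDPer)

-- `Site` alone would resolve to the torus sites of `Setup.lean`; re-export the `ℤ^d` sites of `B7Prop1Explicit`.
export B7Prop1Explicit (Site)

/-- ★★★ **THE SOURCED b9-SOCKET OF PROPOSITION 3's FRAME HOLDS AT EVERY LAW MEMBER OVER A PERIODISED SECT.-F TOWER OF ONE SHAPE** (the slot's `SB9srcHP` text with
`i.η, i.k, i.Ω, i.Λs i.k`; hypotheses `IdxB8Laws`, `DomainSeq`, the (1.5) tower clause).  For `θ.D ≥ 2`, `θ.L ≤ ρ`, `k ≥ 1`, `β ≥ 0`, `len z ≥ 1` (`z ≠ 0`), `θ.𝔸`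
finite-dimensional and every `γ₈ > 0`: `∃ B₀ B₀β cP3 γ″ γβ > 0` such that for every centre `a`, every period `P` with `θ.Lᵏ ∣ P`, `θ.Lᵏ·M + 2·ρ·gs θ.L k ≤ P`, and every law
member `i` with `i.Ω = periodize (fun _ ↦ P) (cubeFam true θ.L a M ρ k)`, `i.k = k`, the five sourced lines of (1.59) hold with `B₀(|J|₍₋₃₎ + |B₁|) + γ″B₀(α₀+α₁)` (line 5:
`B₀β(…) + γβ(α₀+α₁)`).  PER SHAPE — NOT [4] Thm 3.3. [cite: Balaban1985RegularSpaces, (1.146) p.101, (1.57)–(1.59) p.86, (1.5) p.77, (1.68) p.88, (1.131) p.99, p.77 («Ω_j = T_η»); Balaban1985Variational, (3) p.278; Balaban1985BackgroundPropagators, Thm 3.3 p.399; Balaban1984PropagatorsII, (2.1)–(2.3) p.224] -/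
theorem sockB9P3src_periodize_lawMember (θ : Stage3Params) [FiniteDimensional ℂ θ.𝔸] (hD : 2 ≤ θ.D) (M : ℕ) {ρ : ℕ} (hρ : θ.L ≤ ρ)
    {k : ℕ} (hk : 1 ≤ k) {β : ℝ} (hβ : 0 ≤ β) {len : Site θ.D → ℝ} (hlen : ∀ z : Site θ.D, z ≠ 0 → 1 ≤ len z) {γ₈ : ℝ} (hγ₈ : 0 < γ₈) :
    ∃ B₀ B₀β cP3 γ'' γβ : ℝ, 0 < B₀ ∧ 0 < B₀β ∧ 0 < cP3 ∧ 0 < γ'' ∧ 0 < γβ ∧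
      ∀ (a : Site θ.D) (P : ℕ), θ.L ^ k ∣ P → θ.L ^ k * M + 2 * (ρ * gs θ.L k) ≤ P →
      ∀ i : ZdIdx θ.D θ.L, i.Ω = periodize (fun _ : Fin θ.D => P) (cubeFam true θ.L a M ρ k) → i.k = k →
      IdxB8Laws θ.L i → DomainSeq θ.L i.Ω → (∀ l, l < i.k → ∀ z ∈ i.Λs i.k l, ((θ.L : ℤ) ^ l) • z ∈ Lam θ.L i.Ω l) →
      ∀ α₀ α₁ α₂ : ℝ, 0 < α₀ → α₀ ≤ cP3 → 0 < α₁ → 0 < α₂ → α₂ ≤ cP3 →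
        ∀ (U₀ W : Site θ.D → Fin θ.D → θ.𝔸ˣ), (∀ x κ, U₀ x κ ∈ unitaryUnits θ.𝔸) → (∀ x κ, W x κ ∈ unitaryUnits θ.𝔸) →
        ∀ f : Site θ.D → θ.𝔸, InR138 θ.L i.k i.η (i.Ω 0) (i.Λs i.k) U₀ f →
        (∀ x, IsSelfAdjoint (f x)) → (∀ x, x ∉ i.Ω 0 → f x = 0) →
        Bdd θ.L i.k i.η (-(2 : ℝ)) (fun j (x : Site θ.D) => x ∈ i.Ω j) f →
        msup θ.L i.k i.η (-(2 : ℝ)) (fun j (x : Site θ.D) => x ∈ i.Ω j) f < γ₈ * (α₀ + α₁) →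
        msup θ.L i.k i.η (-(3 : ℝ)) (fun j (p : Fin θ.D × Site θ.D) => p.2 ∈ i.Ω j) (fun p => covDerivFwd i.η U₀ p.1 f p.2) < γ₈ * (α₀ + α₁) →
        InAk θ.L i.k i.η α₀ i.Ω U₀ → InAk θ.L i.k i.η α₀ i.Ω (mulCfg W U₀) → IsLandau146W θ.L i.k i.η (i.Ω 0) (i.Λs i.k) U₀ f W →
        ∀ A' : Site θ.D → Fin θ.D → θ.𝔸, (∀ y τ, IsSelfAdjoint (A' y τ)) →
        (∀ j, j ≤ i.k → ∀ (y : Site θ.D) (τ : Fin θ.D), SideTouches (i.Ω j) y τ →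
          W y τ = cfgExp i.η A' y τ ∧ ‖A' y τ‖ ≤ α₂ * ((θ.L : ℝ) ^ j * i.η)⁻¹) →
        (∀ (y : Site θ.D) (τ : Fin θ.D), (∀ j, j ≤ i.k → ¬ SideTouches (i.Ω j) y τ) → A' y τ = 0) →
        msup θ.L i.k i.η (-(1 : ℝ)) (fun j (b : Site θ.D × Fin θ.D) => SideTouches (i.Ω j) b.1 b.2) (fun b => A' b.1 b.2)
            ≤ B₀ * (bondNorm θ.L i.k i.η (-(3 : ℝ)) i.Ω (fun x μ => Jcur i.η U₀ A' μ x)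
              + wsup 1 (fun p : {p : ℕ × (Site θ.D × Fin θ.D) // p.1 ≤ i.k ∧ p.2 ∈ towerBondsP θ.L i.Ω (i.Λs i.k) p.1} =>
                  linCovIter θ.L U₀ (iEta i.η A') p.1.1 p.1.2.1 p.1.2.2)) + γ'' * B₀ * (α₀ + α₁) ∧
          msup θ.L i.k i.η (-(2 : ℝ)) (fun j (t : Fin θ.D × Fin θ.D × Site θ.D) => SideTouches (i.Ω j) t.2.2 t.2.1)
              (fun t => covDerivFwd i.η U₀ t.1 (fun z => A' z t.2.1) t.2.2)
            ≤ B₀ * (bondNorm θ.L i.k i.η (-(3 : ℝ)) i.Ω (fun x μ => Jcur i.η U₀ A' μ x)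
              + wsup 1 (fun p : {p : ℕ × (Site θ.D × Fin θ.D) // p.1 ≤ i.k ∧ p.2 ∈ towerBondsP θ.L i.Ω (i.Λs i.k) p.1} =>
                  linCovIter θ.L U₀ (iEta i.η A') p.1.1 p.1.2.1 p.1.2.2)) + γ'' * B₀ * (α₀ + α₁) ∧
          bondNorm θ.L i.k i.η (-(3 : ℝ)) i.Ω (fun x μ => pdiv i.η U₀ (plaqCovDeriv i.η U₀ A') μ x)
            ≤ B₀ * (bondNorm θ.L i.k i.η (-(3 : ℝ)) i.Ω (fun x μ => Jcur i.η U₀ A' μ x)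
              + wsup 1 (fun p : {p : ℕ × (Site θ.D × Fin θ.D) // p.1 ≤ i.k ∧ p.2 ∈ towerBondsP θ.L i.Ω (i.Λs i.k) p.1} =>
                  linCovIter θ.L U₀ (iEta i.η A') p.1.1 p.1.2.1 p.1.2.2)) + γ'' * B₀ * (α₀ + α₁) ∧
          bondNorm θ.L i.k i.η (-(3 : ℝ)) i.Ω (fun x μ => covLap i.η U₀ (fun z => A' z μ) x)
            ≤ B₀ * (bondNorm θ.L i.k i.η (-(3 : ℝ)) i.Ω (fun x μ => Jcur i.η U₀ A' μ x)
              + wsup 1 (fun p : {p : ℕ × (Site θ.D × Fin θ.D) // p.1 ≤ i.k ∧ p.2 ∈ towerBondsP θ.L i.Ω (i.Λs i.k) p.1} =>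
                  linCovIter θ.L U₀ (iEta i.η A') p.1.1 p.1.2.1 p.1.2.2)) + γ'' * B₀ * (α₀ + α₁) ∧
          msup θ.L i.k i.η (-(2 + β)) (fun j (q : Fin θ.D × Fin θ.D × (Site θ.D × Site θ.D)) =>
                q.2.2 ∈ AdmPair i.η len ∧ q.2.2.1 ∈ i.Ω j ∧ q.2.2.2 ∈ i.Ω j)
              (fun q => hquot i.η β len U₀ (covDerivFwd i.η U₀ q.1 (fun z => A' z q.2.1)) q.2.2)
            ≤ B₀β * (bondNorm θ.L i.k i.η (-(3 : ℝ)) i.Ω (fun x μ => Jcur i.η U₀ A' μ x)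
              + wsup 1 (fun p : {p : ℕ × (Site θ.D × Fin θ.D) // p.1 ≤ i.k ∧ p.2 ∈ towerBondsP θ.L i.Ω (i.Λs i.k) p.1} =>
                  linCovIter θ.L U₀ (iEta i.η A') p.1.1 p.1.2.1 p.1.2.2)) + γβ * (α₀ + α₁) := by
  have hL : 1 ≤ θ.L := le_trans (by norm_num) θ.two_le_L
  obtain ⟨B₀, B₀β, cP3, γ'', γβ, hB₀, hB₀β, hcP3, hγ'', hγβ, H⟩ :=
    exists_sockB9P3src_periodize (𝔹 := θ.𝔸) hD θ.two_le_L M hρ hk hβ hlen hγ₈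
  refine ⟨B₀, B₀β, cP3, γ'', γβ, hB₀, hB₀β, hcP3, hγ'', hγβ, fun a P hdvd hP i hΩ hkk hlaws hdom h15 => ?_⟩
  have hΛ : ∀ l, l ≤ k → i.Λs k l = B11Eq7Convention.Lam θ.L (periodize (fun _ : Fin θ.D => P) (cubeFam true θ.L a M ρ k)) k l := fun l hl => by
    have h := Λs_eq_lam_of_lamTop hL i hlaws hdom h15 (m := i.k) le_rfl (l := l) (by rw [hkk]; exact hl)
    rwa [hkk, hΩ] at h
  rw [hkk, hΩ]
  exact H a i.η i.hη P hdvd hP i.Λs hΛ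

/-- ★★ **THE SAME WITH [4] (3.40)'s ONE-POINT PAIR CLASS ON LINE 5** (`q.2.2 ∈ AdmPair ∧ q.2.2.1 ∈ Ω_j` — the letter of `B8Prop3SrcZd3HPGamma`'s hypothesis `SB9srcH`
at a family member; from the core `srcLines_periodize`, whose Hölder line runs over any pair class inside the admissible pairs).  Same constants-before-members shape, so for a
family `ι : J → ZdIdx` of law members over periodised Sect.-F towers of ONE shape the constants are uniform in `J`.  PER MEMBER SHAPE — NOT [4] Thm 3.3. [cite: Balaban1985RegularSpaces, (1.146) p.101, (1.59) p.86, (1.5) p.77, (1.131) p.99; Balaban1985BackgroundPropagators, Thm 3.3 p.399, (3.40) p.397] -/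
theorem sockB9P3src_periodize_lawMember_onePoint (θ : Stage3Params) [FiniteDimensional ℂ θ.𝔸] (hD : 2 ≤ θ.D) (M : ℕ) {ρ : ℕ} (hρ : θ.L ≤ ρ)
    {k : ℕ} (hk : 1 ≤ k) {β : ℝ} (hβ : 0 ≤ β) {len : Site θ.D → ℝ} (hlen : ∀ z : Site θ.D, z ≠ 0 → 1 ≤ len z) {γ₈ : ℝ} (hγ₈ : 0 < γ₈) :
    ∃ B₀ B₀β cP3 γ'' γβ : ℝ, 0 < B₀ ∧ 0 < B₀β ∧ 0 < cP3 ∧ 0 < γ'' ∧ 0 < γβ ∧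
      ∀ (a : Site θ.D) (P : ℕ), θ.L ^ k ∣ P → θ.L ^ k * M + 2 * (ρ * gs θ.L k) ≤ P →
      ∀ i : ZdIdx θ.D θ.L, i.Ω = periodize (fun _ : Fin θ.D => P) (cubeFam true θ.L a M ρ k) → i.k = k →
      IdxB8Laws θ.L i → DomainSeq θ.L i.Ω → (∀ l, l < i.k → ∀ z ∈ i.Λs i.k l, ((θ.L : ℤ) ^ l) • z ∈ Lam θ.L i.Ω l) →
      ∀ α₀ α₁ α₂ : ℝ, 0 < α₀ → α₀ ≤ cP3 → 0 < α₁ → 0 < α₂ → α₂ ≤ cP3 →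
        ∀ (U₀ W : Site θ.D → Fin θ.D → θ.𝔸ˣ), (∀ x κ, U₀ x κ ∈ unitaryUnits θ.𝔸) → (∀ x κ, W x κ ∈ unitaryUnits θ.𝔸) →
        ∀ f : Site θ.D → θ.𝔸, InR138 θ.L i.k i.η (i.Ω 0) (i.Λs i.k) U₀ f →
        (∀ x, IsSelfAdjoint (f x)) → (∀ x, x ∉ i.Ω 0 → f x = 0) →
        Bdd θ.L i.k i.η (-(2 : ℝ)) (fun j (x : Site θ.D) => x ∈ i.Ω j) f →
        msup θ.L i.k i.η (-(2 : ℝ)) (fun j (x : Site θ.D) => x ∈ i.Ω j) f < γ₈ * (α₀ + α₁) →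
        msup θ.L i.k i.η (-(3 : ℝ)) (fun j (p : Fin θ.D × Site θ.D) => p.2 ∈ i.Ω j) (fun p => covDerivFwd i.η U₀ p.1 f p.2) < γ₈ * (α₀ + α₁) →
        InAk θ.L i.k i.η α₀ i.Ω U₀ → InAk θ.L i.k i.η α₀ i.Ω (mulCfg W U₀) → IsLandau146W θ.L i.k i.η (i.Ω 0) (i.Λs i.k) U₀ f W →
        ∀ A' : Site θ.D → Fin θ.D → θ.𝔸, (∀ y τ, IsSelfAdjoint (A' y τ)) →
        (∀ j, j ≤ i.k → ∀ (y : Site θ.D) (τ : Fin θ.D), SideTouches (i.Ω j) y τ →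
          W y τ = cfgExp i.η A' y τ ∧ ‖A' y τ‖ ≤ α₂ * ((θ.L : ℝ) ^ j * i.η)⁻¹) →
        (∀ (y : Site θ.D) (τ : Fin θ.D), (∀ j, j ≤ i.k → ¬ SideTouches (i.Ω j) y τ) → A' y τ = 0) →
        msup θ.L i.k i.η (-(1 : ℝ)) (fun j (b : Site θ.D × Fin θ.D) => SideTouches (i.Ω j) b.1 b.2) (fun b => A' b.1 b.2)
            ≤ B₀ * (bondNorm θ.L i.k i.η (-(3 : ℝ)) i.Ω (fun x μ => Jcur i.η U₀ A' μ x)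
              + wsup 1 (fun p : {p : ℕ × (Site θ.D × Fin θ.D) // p.1 ≤ i.k ∧ p.2 ∈ towerBondsP θ.L i.Ω (i.Λs i.k) p.1} =>
                  linCovIter θ.L U₀ (iEta i.η A') p.1.1 p.1.2.1 p.1.2.2)) + γ'' * B₀ * (α₀ + α₁) ∧
          msup θ.L i.k i.η (-(2 : ℝ)) (fun j (t : Fin θ.D × Fin θ.D × Site θ.D) => SideTouches (i.Ω j) t.2.2 t.2.1)
              (fun t => covDerivFwd i.η U₀ t.1 (fun z => A' z t.2.1) t.2.2)
            ≤ B₀ * (bondNorm θ.L i.k i.η (-(3 : ℝ)) i.Ω (fun x μ => Jcur i.η U₀ A' μ x)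
              + wsup 1 (fun p : {p : ℕ × (Site θ.D × Fin θ.D) // p.1 ≤ i.k ∧ p.2 ∈ towerBondsP θ.L i.Ω (i.Λs i.k) p.1} =>
                  linCovIter θ.L U₀ (iEta i.η A') p.1.1 p.1.2.1 p.1.2.2)) + γ'' * B₀ * (α₀ + α₁) ∧
          bondNorm θ.L i.k i.η (-(3 : ℝ)) i.Ω (fun x μ => pdiv i.η U₀ (plaqCovDeriv i.η U₀ A') μ x)
            ≤ B₀ * (bondNorm θ.L i.k i.η (-(3 : ℝ)) i.Ω (fun x μ => Jcur i.η U₀ A' μ x)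
              + wsup 1 (fun p : {p : ℕ × (Site θ.D × Fin θ.D) // p.1 ≤ i.k ∧ p.2 ∈ towerBondsP θ.L i.Ω (i.Λs i.k) p.1} =>
                  linCovIter θ.L U₀ (iEta i.η A') p.1.1 p.1.2.1 p.1.2.2)) + γ'' * B₀ * (α₀ + α₁) ∧
          bondNorm θ.L i.k i.η (-(3 : ℝ)) i.Ω (fun x μ => covLap i.η U₀ (fun z => A' z μ) x)
            ≤ B₀ * (bondNorm θ.L i.k i.η (-(3 : ℝ)) i.Ω (fun x μ => Jcur i.η U₀ A' μ x)
              + wsup 1 (fun p : {p : ℕ × (Site θ.D × Fin θ.D) // p.1 ≤ i.k ∧ p.2 ∈ towerBondsP θ.L i.Ω (i.Λs i.k) p.1} =>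
                  linCovIter θ.L U₀ (iEta i.η A') p.1.1 p.1.2.1 p.1.2.2)) + γ'' * B₀ * (α₀ + α₁) ∧
          msup θ.L i.k i.η (-(2 + β)) (fun j (q : Fin θ.D × Fin θ.D × (Site θ.D × Site θ.D)) => q.2.2 ∈ AdmPair i.η len ∧ q.2.2.1 ∈ i.Ω j)
              (fun q => hquot i.η β len U₀ (covDerivFwd i.η U₀ q.1 (fun z => A' z q.2.1)) q.2.2)
            ≤ B₀β * (bondNorm θ.L i.k i.η (-(3 : ℝ)) i.Ω (fun x μ => Jcur i.η U₀ A' μ x)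
              + wsup 1 (fun p : {p : ℕ × (Site θ.D × Fin θ.D) // p.1 ≤ i.k ∧ p.2 ∈ towerBondsP θ.L i.Ω (i.Λs i.k) p.1} =>
                  linCovIter θ.L U₀ (iEta i.η A') p.1.1 p.1.2.1 p.1.2.2)) + γβ * (α₀ + α₁) := by
  have hL : 1 ≤ θ.L := le_trans (by norm_num) θ.two_le_L
  obtain ⟨B₀, B₀β, cP3, γ'', γβ, hB₀, hB₀β, hcP3, hγ'', hγβ, H⟩ :=
    srcLines_periodize (𝔹 := θ.𝔸) hD θ.two_le_L M hρ hk hβ hlen hγ₈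
  refine ⟨B₀, B₀β, cP3, γ'', γβ, hB₀, hB₀β, hcP3, hγ'', hγβ, fun a P hdvd hP i hΩ hkk hlaws hdom h15 => ?_⟩
  have hΛ : ∀ l, l ≤ k → i.Λs k l = B11Eq7Convention.Lam θ.L (periodize (fun _ : Fin θ.D => P) (cubeFam true θ.L a M ρ k)) k l := fun l hl => by
    have h := Λs_eq_lam_of_lamTop hL i hlaws hdom h15 (m := i.k) le_rfl (l := l) (by rw [hkk]; exact hl)
    rwa [hkk, hΩ] at h
  obtain ⟨q, hq⟩ := hdvd
  rw [hkk, hΩ]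
  exact H a i.η i.hη P q (by rw [hq]; push_cast; ring) hP _ i.Λs rfl hΛ
    (fun j p => p.2.2 ∈ AdmPair i.η len ∧ p.2.2.1 ∈ periodize (fun _ : Fin θ.D => P) (cubeFam true θ.L a M ρ k) j) fun _ _ h => h.1

/-- ★★★ **THE SAME AT EVERY MEMBER OF THE PERIODIC CUT `IdxB8SubDPer θ P` OVER A PERIODISED SECT.-F TOWER OF ONE SHAPE** (laws, (1.3)–(1.4), (1.5), periodicity are
the index's fields). [cite: Balaban1985RegularSpaces, (1.146) p.101, (1.59) p.86, (1.5) p.77, (1.131) p.99, p.77 («Ω_j = T_η»); Balaban1985BackgroundPropagators, Thm 3.3 p.399] -/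
theorem sockB9P3src_periodize_idxB8SubDPer (θ : Stage3Params) [FiniteDimensional ℂ θ.𝔸] (hD : 2 ≤ θ.D) (M : ℕ) {ρ : ℕ} (hρ : θ.L ≤ ρ)
    {k : ℕ} (hk : 1 ≤ k) {β : ℝ} (hβ : 0 ≤ β) {len : Site θ.D → ℝ} (hlen : ∀ z : Site θ.D, z ≠ 0 → 1 ≤ len z) {γ₈ : ℝ} (hγ₈ : 0 < γ₈) :
    ∃ B₀ B₀β cP3 γ'' γβ : ℝ, 0 < B₀ ∧ 0 < B₀β ∧ 0 < cP3 ∧ 0 < γ'' ∧ 0 < γβ ∧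
      ∀ (a : Site θ.D) (P : ℕ), θ.L ^ k ∣ P → θ.L ^ k * M + 2 * (ρ * gs θ.L k) ≤ P →
      ∀ j : IdxB8SubDPer θ P, j.1.1.1.1.1.Ω = periodize (fun _ : Fin θ.D => P) (cubeFam true θ.L a M ρ k) → j.1.1.1.1.1.k = k →
      ∀ α₀ α₁ α₂ : ℝ, 0 < α₀ → α₀ ≤ cP3 → 0 < α₁ → 0 < α₂ → α₂ ≤ cP3 →
        ∀ (U₀ W : Site θ.D → Fin θ.D → θ.𝔸ˣ), (∀ x κ, U₀ x κ ∈ unitaryUnits θ.𝔸) → (∀ x κ, W x κ ∈ unitaryUnits θ.𝔸) →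
        ∀ f : Site θ.D → θ.𝔸, InR138 θ.L j.1.1.1.1.1.k j.1.1.1.1.1.η (j.1.1.1.1.1.Ω 0) (j.1.1.1.1.1.Λs j.1.1.1.1.1.k) U₀ f →
        (∀ x, IsSelfAdjoint (f x)) → (∀ x, x ∉ j.1.1.1.1.1.Ω 0 → f x = 0) →
        Bdd θ.L j.1.1.1.1.1.k j.1.1.1.1.1.η (-(2 : ℝ)) (fun l (x : Site θ.D) => x ∈ j.1.1.1.1.1.Ω l) f →
        msup θ.L j.1.1.1.1.1.k j.1.1.1.1.1.η (-(2 : ℝ)) (fun l (x : Site θ.D) => x ∈ j.1.1.1.1.1.Ω l) f < γ₈ * (α₀ + α₁) →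
        msup θ.L j.1.1.1.1.1.k j.1.1.1.1.1.η (-(3 : ℝ)) (fun l (p : Fin θ.D × Site θ.D) => p.2 ∈ j.1.1.1.1.1.Ω l)
          (fun p => covDerivFwd j.1.1.1.1.1.η U₀ p.1 f p.2) < γ₈ * (α₀ + α₁) →
        InAk θ.L j.1.1.1.1.1.k j.1.1.1.1.1.η α₀ j.1.1.1.1.1.Ω U₀ → InAk θ.L j.1.1.1.1.1.k j.1.1.1.1.1.η α₀ j.1.1.1.1.1.Ω (mulCfg W U₀) →
        IsLandau146W θ.L j.1.1.1.1.1.k j.1.1.1.1.1.η (j.1.1.1.1.1.Ω 0) (j.1.1.1.1.1.Λs j.1.1.1.1.1.k) U₀ f W →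
        ∀ A' : Site θ.D → Fin θ.D → θ.𝔸, (∀ y τ, IsSelfAdjoint (A' y τ)) →
        (∀ l, l ≤ j.1.1.1.1.1.k → ∀ (y : Site θ.D) (τ : Fin θ.D), SideTouches (j.1.1.1.1.1.Ω l) y τ →
          W y τ = cfgExp j.1.1.1.1.1.η A' y τ ∧ ‖A' y τ‖ ≤ α₂ * ((θ.L : ℝ) ^ l * j.1.1.1.1.1.η)⁻¹) →
        (∀ (y : Site θ.D) (τ : Fin θ.D), (∀ l, l ≤ j.1.1.1.1.1.k → ¬ SideTouches (j.1.1.1.1.1.Ω l) y τ) → A' y τ = 0) →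
        msup θ.L j.1.1.1.1.1.k j.1.1.1.1.1.η (-(1 : ℝ)) (fun l (b : Site θ.D × Fin θ.D) => SideTouches (j.1.1.1.1.1.Ω l) b.1 b.2) (fun b => A' b.1 b.2)
            ≤ B₀ * (bondNorm θ.L j.1.1.1.1.1.k j.1.1.1.1.1.η (-(3 : ℝ)) j.1.1.1.1.1.Ω (fun x μ => Jcur j.1.1.1.1.1.η U₀ A' μ x)
              + wsup 1 (fun p : {p : ℕ × (Site θ.D × Fin θ.D) //
                  p.1 ≤ j.1.1.1.1.1.k ∧ p.2 ∈ towerBondsP θ.L j.1.1.1.1.1.Ω (j.1.1.1.1.1.Λs j.1.1.1.1.1.k) p.1} =>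
                  linCovIter θ.L U₀ (iEta j.1.1.1.1.1.η A') p.1.1 p.1.2.1 p.1.2.2)) + γ'' * B₀ * (α₀ + α₁) ∧
          msup θ.L j.1.1.1.1.1.k j.1.1.1.1.1.η (-(2 : ℝ)) (fun l (t : Fin θ.D × Fin θ.D × Site θ.D) => SideTouches (j.1.1.1.1.1.Ω l) t.2.2 t.2.1)
              (fun t => covDerivFwd j.1.1.1.1.1.η U₀ t.1 (fun z => A' z t.2.1) t.2.2)
            ≤ B₀ * (bondNorm θ.L j.1.1.1.1.1.k j.1.1.1.1.1.η (-(3 : ℝ)) j.1.1.1.1.1.Ω (fun x μ => Jcur j.1.1.1.1.1.η U₀ A' μ x)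
              + wsup 1 (fun p : {p : ℕ × (Site θ.D × Fin θ.D) //
                  p.1 ≤ j.1.1.1.1.1.k ∧ p.2 ∈ towerBondsP θ.L j.1.1.1.1.1.Ω (j.1.1.1.1.1.Λs j.1.1.1.1.1.k) p.1} =>
                  linCovIter θ.L U₀ (iEta j.1.1.1.1.1.η A') p.1.1 p.1.2.1 p.1.2.2)) + γ'' * B₀ * (α₀ + α₁) ∧
          bondNorm θ.L j.1.1.1.1.1.k j.1.1.1.1.1.η (-(3 : ℝ)) j.1.1.1.1.1.Ω (fun x μ => pdiv j.1.1.1.1.1.η U₀ (plaqCovDeriv j.1.1.1.1.1.η U₀ A') μ x)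
            ≤ B₀ * (bondNorm θ.L j.1.1.1.1.1.k j.1.1.1.1.1.η (-(3 : ℝ)) j.1.1.1.1.1.Ω (fun x μ => Jcur j.1.1.1.1.1.η U₀ A' μ x)
              + wsup 1 (fun p : {p : ℕ × (Site θ.D × Fin θ.D) //
                  p.1 ≤ j.1.1.1.1.1.k ∧ p.2 ∈ towerBondsP θ.L j.1.1.1.1.1.Ω (j.1.1.1.1.1.Λs j.1.1.1.1.1.k) p.1} =>
                  linCovIter θ.L U₀ (iEta j.1.1.1.1.1.η A') p.1.1 p.1.2.1 p.1.2.2)) + γ'' * B₀ * (α₀ + α₁) ∧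
          bondNorm θ.L j.1.1.1.1.1.k j.1.1.1.1.1.η (-(3 : ℝ)) j.1.1.1.1.1.Ω (fun x μ => covLap j.1.1.1.1.1.η U₀ (fun z => A' z μ) x)
            ≤ B₀ * (bondNorm θ.L j.1.1.1.1.1.k j.1.1.1.1.1.η (-(3 : ℝ)) j.1.1.1.1.1.Ω (fun x μ => Jcur j.1.1.1.1.1.η U₀ A' μ x)
              + wsup 1 (fun p : {p : ℕ × (Site θ.D × Fin θ.D) //
                  p.1 ≤ j.1.1.1.1.1.k ∧ p.2 ∈ towerBondsP θ.L j.1.1.1.1.1.Ω (j.1.1.1.1.1.Λs j.1.1.1.1.1.k) p.1} =>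
                  linCovIter θ.L U₀ (iEta j.1.1.1.1.1.η A') p.1.1 p.1.2.1 p.1.2.2)) + γ'' * B₀ * (α₀ + α₁) ∧
          msup θ.L j.1.1.1.1.1.k j.1.1.1.1.1.η (-(2 + β)) (fun l (q : Fin θ.D × Fin θ.D × (Site θ.D × Site θ.D)) =>
                q.2.2 ∈ AdmPair j.1.1.1.1.1.η len ∧ q.2.2.1 ∈ j.1.1.1.1.1.Ω l ∧ q.2.2.2 ∈ j.1.1.1.1.1.Ω l)
              (fun q => hquot j.1.1.1.1.1.η β len U₀ (covDerivFwd j.1.1.1.1.1.η U₀ q.1 (fun z => A' z q.2.1)) q.2.2)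
            ≤ B₀β * (bondNorm θ.L j.1.1.1.1.1.k j.1.1.1.1.1.η (-(3 : ℝ)) j.1.1.1.1.1.Ω (fun x μ => Jcur j.1.1.1.1.1.η U₀ A' μ x)
              + wsup 1 (fun p : {p : ℕ × (Site θ.D × Fin θ.D) //
                  p.1 ≤ j.1.1.1.1.1.k ∧ p.2 ∈ towerBondsP θ.L j.1.1.1.1.1.Ω (j.1.1.1.1.1.Λs j.1.1.1.1.1.k) p.1} =>
                  linCovIter θ.L U₀ (iEta j.1.1.1.1.1.η A') p.1.1 p.1.2.1 p.1.2.2)) + γβ * (α₀ + α₁) := by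
  obtain ⟨B₀, B₀β, cP3, γ'', γβ, hB₀, hB₀β, hcP3, hγ'', hγβ, H⟩ := sockB9P3src_periodize_lawMember θ hD M hρ hk hβ hlen hγ₈
  exact ⟨B₀, B₀β, cP3, γ'', γβ, hB₀, hB₀β, hcP3, hγ'', hγβ, fun a P hdvd hP j hΩ hkk =>
    H a P hdvd hP j.1.1.1.1.1 hΩ hkk j.1.1.1.2.toIdxB8Laws j.1.1.2 j.1.2⟩

end Literature.MathematicalPhysics.QuantumFieldTheory.Balaban1983to89.B8SockB9P3SrcAtPeriodizedTowerMember

end
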